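import Summits.BirchSwinnertonDyer.BirchSwinnertonDyer.Theorems.GenusKolyvaginAtTwoPowDvdShaCardAtTwoRTEigenNorms
import HarnessLib

/-!
# Route `GenusKolyvaginAtTwo`, crux L_T `PowDvdShaCardAtTwoRT` (stmt-BirchSwinnertonDyer-23242), LINE 18 stub 3a⁗ —
# the loop's index hypothesis over `K` at `2`: on `τ`-EIGEN classes a strict local condition at a Kolyvagin prime has index `∣ 2`

LEAD seat `bsd-line-gk2-p1` g15 (cell `bsd-f1-sign2`), `--supports stmt-BirchSwinnertonDyer-23242` (helper). Pure algebra over `…RTEigenNorms`;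
THEOREMS ONLY. BSD is not proved by this file; neither is the crux or the stub.

WHY (memo `Cruxes/PowDvdShaCardAtTwoRT/Lines/plus-descent-lead-g15-v2.md` §5). gk2-p2's prime-swapping loop
(`exists_good_separating_of_swapOracle`, `…RTPrimeSwapping`) needs `hK : (A ℓ).relIndex C[p] ∣ p`: each strict condition «`c_λ = 0`» cuts
the `p`-torsion of the subgroup to be separated by at most one factor `p` (McCallum's characters `φ_{Frob(λ)}` are `ℤ/p`-valued on `C[p]`
because the local group `(E(K_λ)/p^M)^±` is CYCLIC). Over `K` at `2` the unramified coordinate of a class lives in `E[2^L] ≅ R_L = ℤ/2^L[C₂]`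
(rank two), so for an arbitrary `C` the index is only `∣ 4`; but for `τ`-EIGEN classes (`τ·c = ±c` — Kolyvagin classes, and the
previously exhibited subgroup, are eigen) the coordinate `P` of a `2`-torsion class satisfies `τP = ±P = P`, `2P = 0`, hence lies in the
`2`-torsion of the norm line `ℤ(P₀ + τP₀)` (`exists_eq_zsmul_norm_of_tau_eq`, `addOrderOf_norm_eq` — route item Q1 makes `E[2^L]` free),
a group of order `2`: **the strict condition has index `∣ 2` on `C_ε[2]`** (`relIndex_ker_inf_torsionBy_two_dvd_two`). This is the
`K`-side form of the route's `CyclicFixedPartOfNegDisc` input to the loop.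

References: [McCallumLMS1991] §3 (3), §5 proof of Prop. 5.2 (the characters `φ_{Frob(λ_L)}`); [GrossLMS1991] §4.
-/

set_option autoImplicit false
-- `Summit.<P>.<Sub>` repeats `BirchSwinnertonDyer` by the tree's layout convention (D-0017)
set_option linter.dupNamespace false

namespace Summit.BirchSwinnertonDyer.BirchSwinnertonDyer.Theorems.GenusExact.PlusDescent

section EigenIndex

variable {V A : Type*} [AddCommGroup V] [AddCommGroup A]

/-- **`2`-torsion `τ`-fixed vectors of a free rank-one `ℤ/2^L[C₂]`-module lie on the line through `2^{L−1}(P₀ + τP₀)`.**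
[cite: McCallumLMS1991, §3 (the ⟨τ⟩-basis of E[p^M])] -/
theorem mem_zmultiples_half_norm_of_tau_eq_of_two_smul (τ : A →+ A) (hτ : ∀ x, τ (τ x) = x) {L : ℕ} (hL : 1 ≤ L) (P₀ : A)
    (hspan : ∀ Q : A, ∃ a b : ℤ, Q = a • P₀ + b • τ P₀)
    (hfree : ∀ a b : ℤ, a • P₀ + b • τ P₀ = 0 → (2 ^ L : ℤ) ∣ a ∧ (2 ^ L : ℤ) ∣ b)
    (htor : (2 ^ L : ℤ) • P₀ = 0) {P : A} (hP : τ P = P) (h2 : (2 : ℤ) • P = 0) :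
    P ∈ AddSubgroup.zmultiples ((2 ^ (L - 1) : ℤ) • (P₀ + τ P₀)) := by
  obtain ⟨a, rfl⟩ := exists_eq_zsmul_norm_of_tau_eq τ hτ P₀ hspan hfree htor hP
  -- `2a • n₊ = 0` with `ord n₊ = 2^L` forces `2^L ∣ 2a`, i.e. `2^(L-1) ∣ a`
  have hn := addOrderOf_norm_eq τ P₀ hfree htor
  have hdvd : ((2 ^ L : ℕ) : ℤ) ∣ 2 * a := by
    rw [← hn, addOrderOf_dvd_iff_zsmul_eq_zero]
    rw [smul_smul] at h2
    exact h2
  obtain ⟨n, rfl⟩ : ∃ n, L = n + 1 := ⟨L - 1, by omega⟩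
  rw [Nat.add_sub_cancel]
  have hdvd' : (2 : ℤ) ^ n ∣ a := by
    have : ((2 ^ (n + 1) : ℕ) : ℤ) = 2 * 2 ^ n := by push_cast; ring
    rw [this] at hdvd
    exact (mul_dvd_mul_iff_left two_ne_zero).mp hdvd
  obtain ⟨k, rfl⟩ := hdvd'
  rw [AddSubgroup.mem_zmultiples_iff]
  exact ⟨k, by rw [smul_smul, mul_comm]⟩

/-- The element `2^{L−1}(P₀ + τP₀)` is killed by `2`. [folklore] -/
theorem two_zsmul_half_norm_eq_zero (τ : A →+ A) {L : ℕ} (hL : 1 ≤ L) (P₀ : A) (htor : (2 ^ L : ℤ) • P₀ = 0) :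
    (2 : ℤ) • ((2 ^ (L - 1) : ℤ) • (P₀ + τ P₀)) = 0 := by
  rw [smul_smul, ← pow_succ', show L - 1 + 1 = L by omega, zsmul_add, htor, two_pow_zsmul_tau_eq_zero τ P₀ htor, add_zero]

/-- **The strict condition has index `∣ 2` on `τ`-eigen `2`-torsion classes** (the loop's `hK` over `K` at `2`). Data: classes `V` with an
involution-compatible additive `τV`, coordinates `A` (a free rank-one `ℤ/2^L[C₂]`-module on `P₀`, route item Q1), a `τ`-equivariant
«localisation» `loc : V →+ A` (`loc (τV c) = τ (loc c)`: the unramified coordinate at an inert prime transforms by `τ`), a subgroup `C`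
of `ε`-EIGENCLASSES (`τV c = ε • c` on `C`, `ε = ±1`). Then `(ker loc).relIndex (C ⊓ V[2]) ∣ 2`: the image of `C[2]` under `loc` lies in
the order-`2` group `ℤ·2^{L−1}(P₀ + τP₀)`. [cite: McCallumLMS1991, §5 proof of Prop. 5.2 (characters φ_{Frob(λ)} on C[p]); §3 (3)] -/
theorem relIndex_ker_inf_torsionBy_two_dvd_two (τ : A →+ A) (hτ : ∀ x, τ (τ x) = x) {L : ℕ} (hL : 1 ≤ L) (P₀ : A)
    (hspan : ∀ Q : A, ∃ a b : ℤ, Q = a • P₀ + b • τ P₀)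
    (hfree : ∀ a b : ℤ, a • P₀ + b • τ P₀ = 0 → (2 ^ L : ℤ) ∣ a ∧ (2 ^ L : ℤ) ∣ b)
    (htor : (2 ^ L : ℤ) • P₀ = 0)
    (τV : V →+ V) (loc : V →+ A) (hequiv : ∀ c, loc (τV c) = τ (loc c))
    (C : AddSubgroup V) {ε : ℤ} (hε : ε = 1 ∨ ε = -1) (heigen : ∀ c ∈ C, τV c = ε • c) :
    loc.ker.relIndex (C ⊓ AddSubgroup.torsionBy V (2 : ℤ)) ∣ 2 := by
  set H : AddSubgroup V := C ⊓ AddSubgroup.torsionBy V (2 : ℤ) with hH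
  set h : A := (2 ^ (L - 1) : ℤ) • (P₀ + τ P₀) with hh
  -- the restriction of `loc` to `H` and its kernel
  set f : H →+ A := loc.comp H.subtype with hf
  have hker : loc.ker.addSubgroupOf H = f.ker := by
    rw [AddSubgroup.addSubgroupOf, AddMonoidHom.comap_ker]
  -- the image lies on the line through `h`
  have hrange : f.range ≤ AddSubgroup.zmultiples h := by
    rintro _ ⟨⟨c, hc⟩, rfl⟩
    obtain ⟨hcC, hc2⟩ := AddSubgroup.mem_inf.mp hc
    have h2c : (2 : ℤ) • c = 0 := hc2
    have h2P : (2 : ℤ) • loc c = 0 := by rw [← map_zsmul, h2c, map_zero]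
    have hτP : τ (loc c) = loc c := by
      rw [← hequiv, heigen c hcC, map_zsmul]
      rcases hε with rfl | rfl
      · rw [one_zsmul]
      · rw [neg_one_zsmul, neg_eq_iff_add_eq_zero, ← two_zsmul, h2P]
    exact mem_zmultiples_half_norm_of_tau_eq_of_two_smul τ hτ hL P₀ hspan hfree htor hτP h2P
  -- index of the kernel = size of the image, which divides `#ℤh ∣ 2`
  rw [AddSubgroup.relIndex, hker, AddSubgroup.index_ker]
  have h1 : Nat.card f.range ∣ Nat.card (AddSubgroup.zmultiples h) := AddSubgroup.card_dvd_of_le hrange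
  have h2 : Nat.card (AddSubgroup.zmultiples h) ∣ 2 := by
    rw [Nat.card_zmultiples]
    have h0 : (2 : ℤ) • h = 0 := two_zsmul_half_norm_eq_zero τ hL P₀ htor
    have h0' : (2 : ℕ) • h = 0 := by rw [← natCast_zsmul]; exact_mod_cast h0
    exact addOrderOf_dvd_of_nsmul_eq_zero h0'
  exact h1.trans h2

end EigenIndex

end Summit.BirchSwinnertonDyer.BirchSwinnertonDyer.Theorems.GenusExact.PlusDescent
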